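import Mathlib.Analysis.Fourier.AddCircleMulti
import Mathlib.MeasureTheory.Constructions.Polish.StronglyMeasurable
import Mathlib.MeasureTheory.Integral.IntervalIntegral.Basic
import Literature.Analysis.FunctionSpaces.TorusLipschitzFourierH1
import Literature.Analysis.FunctionSpaces.HaarTorusBoundedTrigApprox
import HarnessLib

/-!
# Lines in a coordinate direction of `T^d`: trigonometric sums, their line derivatives, `L²` tails,
# and the translation–Tonelli identity

Analysis/FunctionSpaces support file (everything proved; no definitions, no named facts), part 1 of the coordinate-line
ACL property of spectral `H¹` classes on the torus (`TorusLineAbsContinuity.lean`). Conventions: the Haar PROBABILITY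
measure on `ℝ/ℤ` as a file-local instance (as `Mathlib.Analysis.Fourier.AddCircleMulti` and the tree's
`PeriodicFormDomain.lean`), so that `volume` on `UnitAddTorus d` is the product Haar probability measure for which
Mathlib's `mFourierCoeff`, `mFourierLp`, `mFourierBasis` are stated. For a coordinate `q : d`, the LINE through
`t ∈ T^d` in direction `q` is `x ↦ t + x 𝐞_q` (`x ∈ ℝ`, `x 𝐞_q = Pi.single q (x : ℝ/ℤ)`).

* `mFourier_add_single_coe` (with the tree's `mFourier_apply_add`), `hasDerivAt_mFourier_line` — `e_n(t + x𝐞_q) = e_n(t) e^{2πi n_q x}` and its `x`-derivative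
  `2πi n_q e_n(t + x𝐞_q)`; hence a trigonometric sum `∑_{n ∈ F} c_n e_n` has along every line the derivative
  `∑_{n ∈ F} 2πi n_q c_n e_n` (`hasDerivAt_trigSum_line`);
* `norm_sub_trigTrunc_sq`, `tendsto_norm_sub_trigTrunc_box` — for `f ∈ L²(T^d)` the box truncations
  `∑_{|n_i| ≤ R} f̂(n) e_n` converge to `f` in `L²` (Bessel tail `∑_{n ∉ box} |f̂(n)|²`);
* `exists_Lp_mFourierCoeff_eq` — Riesz–Fischer: an `ℓ²` coefficient family is the Fourier family of an `L²` class;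
* `lintegral_lintegral_line_eq` — **translation–Tonelli**: `∫_{T^d} ∫_{[A,B]} Φ(t + x𝐞_q) dx dt = (B - A) ∫_{T^d} Φ`,
  and its consequence `ae_tendsto_lintegral_line_zero`: if `∑ₖ ∫ Φₖ < ∞` then for a.e. `t` the line integrals
  `∫_{[-M,M]} Φₖ(t + x𝐞_q) dx → 0` for every `M`.

References: L. C. Evans, R. F. Gariepy, *Measure Theory and Fine Properties of Functions* (1992), §4.9.2 (ACL);
L. Grafakos, *Classical Fourier Analysis* (3rd ed.), Prop. 3.2.7. Tagged folklore.
-/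

noncomputable section

open MeasureTheory Set Filter Topology UnitAddTorus Complex
open scoped ENNReal NNReal Interval

namespace Literature.Analysis.FunctionSpaces

namespace Torus

-- File-local convention: the measure on `ℝ/ℤ` is the Haar PROBABILITY measure, re-activating the named local
-- instances of `HaarTorusBoundedTrigApprox.lean` (definitionally those of `Mathlib.Analysis.Fourier.AddCircleMulti`
-- and of the tree's `PeriodicFormDomain.lean`), so that `volume` on `UnitAddTorus d` is the measure for which Mathlib's
-- `mFourierCoeff`, `mFourierLp`, `mFourierBasis` are stated.
attribute [local instance] HaarTorus.haarCircle_measureSpace HaarTorus.haarCircle_isAddHaarMeasure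
  HaarTorus.haarCircle_isProbabilityMeasure HaarTorus.haarTorus_isProbabilityMeasure
  HaarTorus.haarTorus_isAddLeftInvariant HaarTorus.haarTorus_isAddRightInvariant

variable {d : Type*} [Fintype d] [DecidableEq d]

/-! ### Characters along a line -/

/-- A character at a point of the line through `t` in direction `q`:
`e_n(t + x𝐞_q) = e_n(t) exp(i·2π n_q x)`. [folklore] -/
theorem mFourier_add_single_coe (n : d → ℤ) (q : d) (t : UnitAddTorus d) (x : ℝ) :
    mFourier n (t + Pi.single q ((x : ℝ) : UnitAddCircle)) =
      mFourier n t * Complex.exp (Complex.I * ((2 * Real.pi * (n q) * x : ℝ) : ℂ)) := by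
  rw [mFourier_apply_add, mFourier_single_coe]

/-- The `x`-derivative of a character along a line: `d/dx e_n(t + x𝐞_q) = e_n(t + x𝐞_q) · 2πi n_q`. [folklore] -/
theorem hasDerivAt_mFourier_line (n : d → ℤ) (q : d) (t : UnitAddTorus d) (x : ℝ) :
    HasDerivAt (fun y : ℝ => mFourier n (t + Pi.single q ((y : ℝ) : UnitAddCircle)))
      (mFourier n (t + Pi.single q ((x : ℝ) : UnitAddCircle)) * (2 * Real.pi * Complex.I * (n q))) x := by
  set a : ℂ := Complex.I * (2 * Real.pi * (n q)) with ha
  have hfun : (fun y : ℝ => mFourier n (t + Pi.single q ((y : ℝ) : UnitAddCircle))) =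
      fun y : ℝ => mFourier n t * Complex.exp (a * (y : ℂ)) := by
    funext y
    rw [mFourier_add_single_coe]
    congr 2
    push_cast
    ring
  have h1 : HasDerivAt (fun y : ℂ => Complex.exp (a * y)) (Complex.exp (a * (x : ℂ)) * a) (x : ℂ) := by
    have h := (Complex.hasDerivAt_exp (a * (x : ℂ))).comp (x : ℂ) ((hasDerivAt_id (x : ℂ)).const_mul a)
    simpa only [Function.comp_def, id, mul_one] using h
  have h2 := (h1.comp_ofReal).const_mul (mFourier n t)
  rw [hfun]
  refine h2.congr_deriv ?_
  rw [mFourier_add_single_coe]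
  push_cast
  rw [ha]
  ring

/-- **Line derivative of a trigonometric sum**: along every line in direction `q`,
`d/dx ∑_{n ∈ F} c_n e_n(t + x𝐞_q) = ∑_{n ∈ F} (2πi n_q c_n) e_n(t + x𝐞_q)`. [folklore] -/
theorem hasDerivAt_trigSum_line (F : Finset (d → ℤ)) (c : (d → ℤ) → ℂ) (q : d) (t : UnitAddTorus d) (x : ℝ) :
    HasDerivAt (fun y : ℝ => ∑ n ∈ F, c n * mFourier n (t + Pi.single q ((y : ℝ) : UnitAddCircle)))
      (∑ n ∈ F, (2 * Real.pi * Complex.I * (n q) * c n) * mFourier n (t + Pi.single q ((x : ℝ) : UnitAddCircle))) x := by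
  refine HasDerivAt.fun_sum fun n _ => ?_
  exact ((hasDerivAt_mFourier_line n q t x).const_mul (c n)).congr_deriv (by ring)

omit [DecidableEq d] in
/-- A trigonometric sum is continuous. [folklore] -/
theorem continuous_trigSum (F : Finset (d → ℤ)) (c : (d → ℤ) → ℂ) :
    Continuous fun t : UnitAddTorus d => ∑ n ∈ F, c n * mFourier n t :=
  continuous_finsetSum F fun n _ => continuous_const.mul (mFourier n).continuous

/-- A trigonometric sum restricted to a line is continuous. [folklore] -/
theorem continuous_trigSum_line (F : Finset (d → ℤ)) (c : (d → ℤ) → ℂ) (q : d) (t : UnitAddTorus d) :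
    Continuous fun y : ℝ => ∑ n ∈ F, c n * mFourier n (t + Pi.single q ((y : ℝ) : UnitAddCircle)) :=
  continuous_iff_continuousAt.2 fun y => (hasDerivAt_trigSum_line F c q t y).continuousAt

/-! ### Box truncations in `L²(T^d)` -/

/-- The box of momenta `{n : |n_i| ≤ R}`. We use it through `Fintype.piFinset` directly; this lemma records that the boxes
exhaust `ℤ^d` monotonically. [folklore] -/
theorem tendsto_box_atTop :
    Tendsto (fun R : ℕ => (Fintype.piFinset fun _ : d => Finset.Icc (-(R : ℤ)) R : Finset (d → ℤ))) atTop atTop := by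
  refine Monotone.tendsto_atTop_atTop (fun R S h => Fintype.piFinset_subset _ _ fun _ =>
    Finset.Icc_subset_Icc (by simpa using h) (by simpa using h)) fun F => ?_
  -- a box containing the finite set `F`
  obtain ⟨R, hR⟩ : ∃ R : ℕ, ∀ n ∈ F, ∀ i, |n i| ≤ R := by
    classical
    refine ⟨F.sup fun n => Finset.univ.sup fun i => (n i).natAbs, fun n hn i => ?_⟩
    have h1 : (n i).natAbs ≤ Finset.univ.sup fun i => (n i).natAbs := Finset.le_sup (f := fun i => (n i).natAbs) (Finset.mem_univ i)
    have h2 : (Finset.univ.sup fun i => (n i).natAbs) ≤ F.sup fun n => Finset.univ.sup fun i => (n i).natAbs :=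
      Finset.le_sup (f := fun n => Finset.univ.sup fun i => (n i).natAbs) hn
    have h3 := h1.trans h2
    rw [← Int.natCast_natAbs]
    exact_mod_cast h3
  refine ⟨R, fun n hn => Fintype.mem_piFinset.2 fun i => Finset.mem_Icc.2 (abs_le.1 (hR n hn i))⟩

omit [DecidableEq d] in
/-- The trigonometric sum with coefficients `c` on a finite set `F`, as a continuous map. [folklore] -/
theorem exists_continuousMap_trigSum (F : Finset (d → ℤ)) (c : (d → ℤ) → ℂ) :
    ∃ P : C(UnitAddTorus d, ℂ), (∀ t, P t = ∑ n ∈ F, c n * mFourier n t) ∧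
      ContinuousMap.toLp (E := ℂ) 2 volume ℂ P =
        ∑ n ∈ F, c n • (mFourierLp 2 n : Lp ℂ 2 (volume : Measure (UnitAddTorus d))) := by
  refine ⟨∑ n ∈ F, c n • (mFourier n : C(UnitAddTorus d, ℂ)), fun t => ?_, ?_⟩
  · simp only [ContinuousMap.coe_sum, ContinuousMap.coe_smul, Finset.sum_apply, Pi.smul_apply, smul_eq_mul]
  · simp only [map_sum, map_smul]

omit [DecidableEq d] in
/-- **Bessel tail**: for `f ∈ L²(T^d)` and a finite set of momenta `F`,
`‖f - ∑_{n ∈ F} f̂(n) e_n‖² = ∑_{n ∉ F} |f̂(n)|²` (as a `tsum` with the box terms set to `0`). [folklore] -/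
theorem norm_sub_trigTrunc_sq (f : Lp ℂ 2 (volume : Measure (UnitAddTorus d))) (F : Finset (d → ℤ)) :
    ‖f - ∑ n ∈ F, mFourierCoeff (f : UnitAddTorus d → ℂ) n • (mFourierLp 2 n : Lp ℂ 2 (volume : Measure (UnitAddTorus d)))‖ ^ 2 =
      ∑' n : d → ℤ, if n ∈ F then (0 : ℝ) else ‖mFourierCoeff (f : UnitAddTorus d → ℂ) n‖ ^ 2 := by
  classical
  set b := mFourierBasis (d := d) with hb
  set g := f - ∑ n ∈ F, mFourierCoeff (f : UnitAddTorus d → ℂ) n • (mFourierLp 2 n : Lp ℂ 2 (volume : Measure (UnitAddTorus d))) with hg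
  have hrepr : ∀ m, b.repr g m = if m ∈ F then 0 else mFourierCoeff (f : UnitAddTorus d → ℂ) m := fun m => by
    rw [hg, map_sub, map_sum]
    simp only [map_smul, lp.coeFn_sub, Pi.sub_apply, lp.coeFn_sum, Finset.sum_apply, lp.coeFn_smul, Pi.smul_apply,
      smul_eq_mul]
    rw [hb, mFourierBasis_repr]
    have hbasis : ∀ n : d → ℤ, (mFourierBasis (d := d)).repr (mFourierLp 2 n : Lp ℂ 2 (volume : Measure (UnitAddTorus d))) m =
        if m = n then 1 else 0 := fun n => by
      rw [← coe_mFourierBasis, HilbertBasis.repr_self, lp.single_apply, Pi.single_apply]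
    simp only [hbasis, mul_ite, mul_one, mul_zero, Finset.sum_ite_eq]
    split_ifs <;> simp
  have hsum := lp.hasSum_norm (by norm_num : 0 < (2 : ℝ≥0∞).toReal) (b.repr g)
  simp only [ENNReal.toReal_ofNat, Real.rpow_two, hrepr, LinearIsometryEquiv.norm_map] at hsum
  have heq : (fun m => ‖(if m ∈ F then (0 : ℂ) else mFourierCoeff (f : UnitAddTorus d → ℂ) m)‖ ^ 2) =
      fun m => if m ∈ F then (0 : ℝ) else ‖mFourierCoeff (f : UnitAddTorus d → ℂ) m‖ ^ 2 := by
    funext m; split_ifs <;> simp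
  rw [heq] at hsum
  exact hsum.tsum_eq.symm

/-- **The box truncations converge in `L²`**: `‖f - ∑_{|n_i| ≤ R} f̂(n) e_n‖ → 0` as `R → ∞`. [folklore] -/
theorem tendsto_norm_sub_trigTrunc_box (f : Lp ℂ 2 (volume : Measure (UnitAddTorus d))) :
    Tendsto (fun R : ℕ => ‖f - ∑ n ∈ (Fintype.piFinset fun _ : d => Finset.Icc (-(R : ℤ)) R),
      mFourierCoeff (f : UnitAddTorus d → ℂ) n • (mFourierLp 2 n : Lp ℂ 2 (volume : Measure (UnitAddTorus d)))‖)
      atTop (𝓝 0) := by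
  classical
  -- the squared norms are the tails of the summable family `|f̂(n)|²`
  have hsumm : Summable fun n : d → ℤ => ‖mFourierCoeff (f : UnitAddTorus d → ℂ) n‖ ^ 2 := (hasSum_sq_mFourierCoeff f).summable
  have htail := (tendsto_tsum_compl_atTop_zero fun n : d → ℤ => ‖mFourierCoeff (f : UnitAddTorus d → ℂ) n‖ ^ 2).comp
    (tendsto_box_atTop (d := d))
  have hsq : Tendsto (fun R : ℕ => ‖f - ∑ n ∈ (Fintype.piFinset fun _ : d => Finset.Icc (-(R : ℤ)) R),
      mFourierCoeff (f : UnitAddTorus d → ℂ) n • (mFourierLp 2 n : Lp ℂ 2 (volume : Measure (UnitAddTorus d)))‖ ^ 2)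
      atTop (𝓝 0) := by
    refine htail.congr fun R => ?_
    rw [Function.comp_apply, norm_sub_trigTrunc_sq]
    refine (tsum_subtype (((Fintype.piFinset fun _ : d => Finset.Icc (-(R : ℤ)) R : Finset (d → ℤ)) : Set (d → ℤ))ᶜ)
      (fun a => ‖mFourierCoeff (f : UnitAddTorus d → ℂ) a‖ ^ 2)).trans (tsum_congr fun n => ?_)
    by_cases hn : n ∈ (Fintype.piFinset fun _ : d => Finset.Icc (-(R : ℤ)) R)
    · rw [if_pos hn, Set.indicator_of_notMem (by rw [Set.mem_compl_iff, Finset.mem_coe]; exact not_not.2 hn)]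
    · rw [if_neg hn, Set.indicator_of_mem (by rw [Set.mem_compl_iff, Finset.mem_coe]; exact hn)]
  have h := (Real.continuous_sqrt.tendsto 0).comp hsq
  rw [Real.sqrt_zero] at h
  refine h.congr fun R => ?_
  rw [Function.comp_apply, Real.sqrt_sq (norm_nonneg _)]

omit [DecidableEq d] in
/-- **Riesz–Fischer on `T^d`**: a square-summable coefficient family is the Fourier family of an `L²` class. [folklore] -/
theorem exists_Lp_mFourierCoeff_eq (c : (d → ℤ) → ℂ) (hc : Summable fun n => ‖c n‖ ^ 2) :
    ∃ h : Lp ℂ 2 (volume : Measure (UnitAddTorus d)), ∀ n, mFourierCoeff (h : UnitAddTorus d → ℂ) n = c n := by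
  have hmem : Memℓp c 2 := memℓp_gen (by simpa using hc)
  refine ⟨(mFourierBasis (d := d)).repr.symm ⟨c, hmem⟩, fun n => ?_⟩
  rw [← mFourierBasis_repr, LinearIsometryEquiv.apply_symm_apply]

/-! ### Translation–Tonelli along lines -/

omit [Fintype d] in
/-- The line map `(t, x) ↦ t + x𝐞_q` is continuous. [folklore] -/
theorem continuous_lineMap (q : d) :
    Continuous fun p : UnitAddTorus d × ℝ => p.1 + Pi.single q ((p.2 : ℝ) : UnitAddCircle) := by
  refine continuous_fst.add ?_
  refine continuous_pi fun i => ?_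
  by_cases hi : i = q
  · subst hi
    simp only [Pi.single_eq_same]
    exact (AddCircle.continuous_mk' (1 : ℝ)).comp continuous_snd
  · simp only [Pi.single_eq_of_ne hi]
    exact continuous_const

/-- **Translation–Tonelli**: for a measurable `Φ ≥ 0` on `T^d`, a coordinate `q` and reals `A, B`,
`∫_{T^d} (∫_{[A,B]} Φ(t + x𝐞_q) dx) dt = (B - A)₊ · ∫_{T^d} Φ` (`ofReal (B - A)`, which is `0` for `B < A`). [folklore] -/
theorem lintegral_lintegral_line_eq (q : d) {Φ : UnitAddTorus d → ℝ≥0∞} (hΦ : Measurable Φ) (A B : ℝ) :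
    ∫⁻ t : UnitAddTorus d, (∫⁻ x in Icc A B, Φ (t + Pi.single q ((x : ℝ) : UnitAddCircle))) =
      ENNReal.ofReal (B - A) * ∫⁻ t, Φ t := by
  have hmeas : Measurable fun p : UnitAddTorus d × ℝ => Φ (p.1 + Pi.single q ((p.2 : ℝ) : UnitAddCircle)) :=
    hΦ.comp (continuous_lineMap q).measurable
  rw [lintegral_lintegral_swap hmeas.aemeasurable]
  have hinner : ∀ x : ℝ, ∫⁻ t : UnitAddTorus d, Φ (t + Pi.single q ((x : ℝ) : UnitAddCircle)) = ∫⁻ t, Φ t := fun x => by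
    have h := lintegral_add_left_eq_self (μ := (volume : Measure (UnitAddTorus d))) Φ
      (Pi.single q ((x : ℝ) : UnitAddCircle))
    simpa only [add_comm] using h
  simp only [hinner]
  rw [setLIntegral_const, Real.volume_Icc, mul_comm]

/-- **Almost every line sees a summable sequence of masses tend to zero.** If `Φₖ ≥ 0` are measurable with
`∑ₖ ∫ Φₖ < ∞`, then for a.e. `t ∈ T^d` and every `M : ℕ`, `∫_{[-M,M]} Φₖ(t + x𝐞_q) dx → 0`. [folklore] -/
theorem ae_tendsto_lintegral_line_zero (q : d) {Φ : ℕ → UnitAddTorus d → ℝ≥0∞} (hΦ : ∀ k, Measurable (Φ k))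
    (hsum : ∑' k, ∫⁻ t, Φ k t ≠ ⊤) :
    ∀ᵐ t ∂(volume : Measure (UnitAddTorus d)), ∀ M : ℕ,
      Tendsto (fun k => ∫⁻ x in Icc (-(M : ℝ)) M, Φ k (t + Pi.single q ((x : ℝ) : UnitAddCircle))) atTop (𝓝 0) := by
  rw [ae_all_iff]
  intro M
  have hmeas : ∀ k, Measurable fun t : UnitAddTorus d =>
      ∫⁻ x in Icc (-(M : ℝ)) M, Φ k (t + Pi.single q ((x : ℝ) : UnitAddCircle)) := fun k =>
    Measurable.lintegral_prod_right (f := fun (t : UnitAddTorus d) (x : ℝ) => Φ k (t + Pi.single q ((x : ℝ) : UnitAddCircle)))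
      ((hΦ k).comp (continuous_lineMap q).measurable)
  -- the total mass over `k` is finite
  have htot : ∫⁻ t : UnitAddTorus d, ∑' k, ∫⁻ x in Icc (-(M : ℝ)) M, Φ k (t + Pi.single q ((x : ℝ) : UnitAddCircle)) ≠ ⊤ := by
    rw [lintegral_tsum fun k => (hmeas k).aemeasurable]
    simp only [lintegral_lintegral_line_eq q (hΦ _), ENNReal.tsum_mul_left]
    exact ENNReal.mul_ne_top ENNReal.ofReal_ne_top hsum
  filter_upwards [ae_lt_top (Measurable.tsum hmeas) htot] with t ht
  exact ENNReal.tendsto_atTop_zero_of_tsum_ne_top ht.ne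

end Torus

end Literature.Analysis.FunctionSpaces

end
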